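import Summits.ValiantsHypothesis.ValiantsHypothesis.Theorems.BarrierLeverPartitionMinorsHitByVPRoabpTransducer

/-!
# Route BarrierLever — item `PartitionMinorsHitByVP` (stmt-ValiantsHypothesis-19717):
# first CLASSES of sequential-transducer layouts hit by the ROABP door

Helper file (`--supports stmt-ValiantsHypothesis-19717`; cell valiant-natproofs, rung V4, 𝒟-side; prover seat val-np-p7 g15,
sub-target (d) of the round-3 owner table). Closes NO item. Each class is an instance of
`RoabpDoor.partitionMinor_hit_of_transducer` (`…RoabpTransducer.lean`): an injective layout `(u, w)` of ANY size `r ≤ 2^h` whose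
columns are the images of its rows (up to a row bijection `ψ`) under a finite-state transducer is hit inside
`SmallCircuits ℂ (2h) (3c+3)`; the certificate is the transducer's 0/1 automaton, whose run-count matrix on `U × W` is the
permutation matrix of `ψ`.
* `partitionMinor_hit_of_cubeAutomorphism` — `w j = φ(u (ψ j)) ∆ S` (one state, width 2); `partitionMinor_hit_of_relabelling` —
  `w j = φ(u (ψ j))`, in particular the principal layouts.
* `partitionMinor_hit_of_grayCode` — reflected binary Gray code `[a ∈ w j] = [a ∈ u (ψ j)] ⊕ [a+1 ∈ u (ψ j)]` (two states, width 4,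
  order `x_{h-1} y_{h-1} x_{h-2} …`); NOT a cube automorphism.
* `partitionMinor_hit_of_successor` — `w j = u (ψ j) + 1 (mod 2^h)` as binary numbers (carry transducer, width 4, LSB first).
* `partitionMinor_hit_of_negation` — `w j = −u (ψ j) (mod 2^h)` (two's complement: flip every bit above the lowest set bit; width 4).
* `partitionMinor_hit_of_prefixParity` — bit `a` of `w j` = parity of the bits `≤ a` of `u (ψ j)` (two states, unbounded memory).
* `partitionMinor_hit_of_slidingWindow` — `bit_a ↦ bit_a ⊕ g_a(bit_{a-1}, …, bit_{a-d})` for ARBITRARY `g_a` (nonlinear unitriangular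
  bijections; `2^d` states, width `2^(d+1) ≤ (2h)^c`: windows `d = O(log h)` — the framework at polynomial, not constant, width).

STATUS OF THE DOOR: its conjecture of record `ROABPHitsPartitionMinors` is REFUTED (`RoabpDoor.not_ROABPHitsPartitionMinors`,
`…RoabpDoorNegative.lean`; planner p1 g17) — these are CERTIFIED-CLASS theorems only; no read-once door carries item 19717.
WHAT THIS IS NOT: transparent (permutation-matrix) certificates only; nothing on crux 14610 or on VP ≠ VNP.
-/

namespace Summit.ValiantsHypothesis.Theorems.BarrierLever.RoabpDoor

open Matrix Finset Literature.Computability.AlgebraicComplexity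

/-- **Cube-automorphism layouts** (one-state transducer): the columns are the rows relabelled by a coordinate permutation `φ`
and translated by a fixed set `S` — `w j = φ(u (ψ j)) ∆ S` — for ANY injective layout of any size `r ≤ 2^h`. Hit at width 2
(`c ≥ 1`, `h ≥ 2`) through the ROABP door. -/
theorem partitionMinor_hit_of_cubeAutomorphism (h c : ℕ) (hc : 2 ≤ (h + h) ^ c) (hh : 4 ≤ h + h)
    (φ : Equiv.Perm (Fin h)) (S : Finset (Fin h)) {r : ℕ} (u w : Fin r → Finset (Fin h))
    (hw : Function.Injective w) (ψ : Equiv.Perm (Fin r))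
    (hφ : ∀ j (a : Fin h), φ a ∈ w j ↔ ¬ (a ∈ u (ψ j) ↔ φ a ∈ S)) :
    ∃ f ∈ Literature.Barriers.ValiantsHypothesis.SmallCircuits ℂ (h + h) (3 * c + 3),
      (Matrix.of fun i j : Fin r => MvPolynomial.coeff
        (∑ a ∈ u i, Finsupp.single (Fin.castAdd h a) 1 + ∑ c ∈ w j, Finsupp.single (Fin.natAdd h c) 1) f).det ≠ 0 := by
  refine partitionMinor_hit_of_transducer (Q := Unit) h 1 c hc hh (fun _ => 0) (fun _ _ _ => rfl)
    1 φ (fun _ _ _ => ()) (fun k _ a => a != decide (φ k ∈ S)) () u w hw ψ (fun _ _ => ()) (fun _ => rfl)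
    (fun _ _ => rfl) fun j k => ?_
  rw [hφ j k, Equiv.Perm.one_apply, bne_iff_ne, ne_eq, decide_eq_decide]

/-- **Relabelled layouts** `w j = φ(u (ψ j))` (in particular the principal layouts `w = u ∘ ψ`): hit at width 2. -/
theorem partitionMinor_hit_of_relabelling (h c : ℕ) (hc : 2 ≤ (h + h) ^ c) (hh : 4 ≤ h + h)
    (φ : Equiv.Perm (Fin h)) {r : ℕ} (u w : Fin r → Finset (Fin h))
    (hw : Function.Injective w) (ψ : Equiv.Perm (Fin r)) (hφ : ∀ j (a : Fin h), φ a ∈ w j ↔ a ∈ u (ψ j)) :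
    ∃ f ∈ Literature.Barriers.ValiantsHypothesis.SmallCircuits ℂ (h + h) (3 * c + 3),
      (Matrix.of fun i j : Fin r => MvPolynomial.coeff
        (∑ a ∈ u i, Finsupp.single (Fin.castAdd h a) 1 + ∑ c ∈ w j, Finsupp.single (Fin.natAdd h c) 1) f).det ≠ 0 :=
  partitionMinor_hit_of_cubeAutomorphism h c hc hh φ ∅ u w hw ψ fun j a => by
    rw [hφ j a]; simp

/-- **Gray-code layouts** (a two-state transducer; NOT a cube automorphism): the columns are the reflected-binary Gray codes
of the rows, `[a ∈ w j] = [a ∈ u (ψ j)] ⊕ [a+1 ∈ u (ψ j)]`, for ANY injective layout of any size `r ≤ 2^h`. Hit at width 4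
(`(2h)^c ≥ 4`, `h ≥ 2`): read `x_{h-1}, y_{h-1}, x_{h-2}, y_{h-2}, …`, state = the previous input bit. -/
theorem partitionMinor_hit_of_grayCode (h c : ℕ) (hc : 4 ≤ (h + h) ^ c) (hh : 4 ≤ h + h)
    {r : ℕ} (u w : Fin r → Finset (Fin h)) (hw : Function.Injective w) (ψ : Equiv.Perm (Fin r))
    (hgray : ∀ j (a : Fin h), a ∈ w j ↔ ¬ (a ∈ u (ψ j) ↔ ∃ b ∈ u (ψ j), (b : ℕ) = a + 1)) :
    ∃ f ∈ Literature.Barriers.ValiantsHypothesis.SmallCircuits ℂ (h + h) (3 * c + 3),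
      (Matrix.of fun i j : Fin r => MvPolynomial.coeff
        (∑ a ∈ u i, Finsupp.single (Fin.castAdd h a) 1 + ∑ c ∈ w j, Finsupp.single (Fin.natAdd h c) 1) f).det ≠ 0 := by
  classical
  refine partitionMinor_hit_of_transducer (Q := Bool) h 2 c hc hh (fun b => if b then 1 else 0)
    (fun b b' hb => by cases b <;> cases b' <;> simp_all)
    Fin.revPerm Fin.revPerm (fun _ _ a => a) (fun _ q a => a != q) false u w hw ψ
    (fun i n => decide (∃ b ∈ u i, (b : ℕ) + n = h)) (fun i => ?_) (fun i k => ?_) fun j k => ?_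
  · simp only [Fin.val_zero, add_zero, decide_eq_false_iff_not, not_exists, not_and]
    intro b _ hb; exact absurd hb (ne_of_lt b.is_lt)
  · rw [decide_eq_decide]
    simp only [Fin.val_succ, Fin.revPerm_apply]
    constructor
    · rintro ⟨b, hb, hbk⟩
      have : b = Fin.rev k := Fin.ext (by rw [Fin.val_rev]; omega)
      rwa [← this]
    · intro hk; exact ⟨Fin.rev k, hk, by rw [Fin.val_rev]; omega⟩
  · rw [Fin.revPerm_apply, hgray j (Fin.rev k), bne_iff_ne, ne_eq, decide_eq_decide, Fin.val_castSucc]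
    have e : (∃ b ∈ u (ψ j), (b : ℕ) = (Fin.rev k : ℕ) + 1) ↔ ∃ b ∈ u (ψ j), (b : ℕ) + k = h := by
      constructor
      · rintro ⟨b, hb, hbk⟩; exact ⟨b, hb, by rw [Fin.val_rev] at hbk; omega⟩
      · rintro ⟨b, hb, hbk⟩; exact ⟨b, hb, by rw [Fin.val_rev]; omega⟩
    rw [e]

/-- **Binary-successor layouts** (the carry transducer, two states): the columns are the rows INCREMENTED BY ONE as binary
numbers mod `2^h` (bit `a` of `w j` = bit `a` of `u (ψ j)` flipped iff all lower bits of `u (ψ j)` are set), for ANY injective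
layout of any size `r ≤ 2^h`. Hit at width 4 (`(2h)^c ≥ 4`, `h ≥ 2`): read `x_0 y_0 x_1 y_1 …` (least significant bit first),
state = the carry. -/
theorem partitionMinor_hit_of_successor (h c : ℕ) (hc : 4 ≤ (h + h) ^ c) (hh : 4 ≤ h + h)
    {r : ℕ} (u w : Fin r → Finset (Fin h)) (hw : Function.Injective w) (ψ : Equiv.Perm (Fin r))
    (hsucc : ∀ j (a : Fin h), a ∈ w j ↔ ¬ (a ∈ u (ψ j) ↔ ∀ b : Fin h, (b : ℕ) < a → b ∈ u (ψ j))) :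
    ∃ f ∈ Literature.Barriers.ValiantsHypothesis.SmallCircuits ℂ (h + h) (3 * c + 3),
      (Matrix.of fun i j : Fin r => MvPolynomial.coeff
        (∑ a ∈ u i, Finsupp.single (Fin.castAdd h a) 1 + ∑ c ∈ w j, Finsupp.single (Fin.natAdd h c) 1) f).det ≠ 0 := by
  classical
  refine partitionMinor_hit_of_transducer (Q := Bool) h 2 c hc hh (fun b => if b then 1 else 0)
    (fun b b' hb => by cases b <;> cases b' <;> simp_all)
    1 1 (fun _ carry a => a && carry) (fun _ carry a => a != carry) true u w hw ψ
    (fun i n => decide (∀ b : Fin h, (b : ℕ) < n → b ∈ u i)) (fun i => ?_) (fun i k => ?_) fun j k => ?_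
  · simp
  · rw [Bool.eq_iff_iff]
    simp only [Fin.val_succ, Equiv.Perm.one_apply, Fin.val_castSucc, Bool.and_eq_true, decide_eq_true_eq]
    constructor
    · intro H
      exact ⟨H k (Nat.lt_succ_self _), fun b hb => H b (Nat.lt_succ_of_lt hb)⟩
    · rintro ⟨hk, H⟩ b hb
      rcases Nat.lt_succ_iff_lt_or_eq.1 hb with hlt | heq
      · exact H b hlt
      · rwa [Fin.ext heq]
  · rw [Equiv.Perm.one_apply, hsucc j k, bne_iff_ne, ne_eq, decide_eq_decide, Fin.val_castSucc]

/-- **Two's-complement NEGATION layouts** (two states): the columns are the rows NEGATED mod `2^h` as binary numbers — bit `a` of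
`w j` = bit `a` of `u (ψ j)` flipped iff some LOWER bit of `u (ψ j)` is set — for ANY injective layout of any size `r ≤ 2^h`.
Hit at width 4 (`(2h)^c ≥ 4`, `h ≥ 2`): read `x_0 y_0 x_1 y_1 …`, state = «a set bit has been seen». -/
theorem partitionMinor_hit_of_negation (h c : ℕ) (hc : 4 ≤ (h + h) ^ c) (hh : 4 ≤ h + h)
    {r : ℕ} (u w : Fin r → Finset (Fin h)) (hw : Function.Injective w) (ψ : Equiv.Perm (Fin r))
    (hneg : ∀ j (a : Fin h), a ∈ w j ↔ ¬ (a ∈ u (ψ j) ↔ ∃ b ∈ u (ψ j), (b : ℕ) < a)) :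
    ∃ f ∈ Literature.Barriers.ValiantsHypothesis.SmallCircuits ℂ (h + h) (3 * c + 3),
      (Matrix.of fun i j : Fin r => MvPolynomial.coeff
        (∑ a ∈ u i, Finsupp.single (Fin.castAdd h a) 1 + ∑ c ∈ w j, Finsupp.single (Fin.natAdd h c) 1) f).det ≠ 0 := by
  classical
  refine partitionMinor_hit_of_transducer (Q := Bool) h 2 c hc hh (fun b => if b then 1 else 0)
    (fun b b' hb => by cases b <;> cases b' <;> simp_all)
    1 1 (fun _ seen a => seen || a) (fun _ seen a => a != seen) false u w hw ψ
    (fun i n => decide (∃ b ∈ u i, (b : ℕ) < n)) (fun i => ?_) (fun i k => ?_) fun j k => ?_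
  · simp
  · rw [Bool.eq_iff_iff]
    simp only [Fin.val_succ, Equiv.Perm.one_apply, Fin.val_castSucc, Bool.or_eq_true, decide_eq_true_eq]
    constructor
    · rintro ⟨b, hb, hbk⟩
      rcases Nat.lt_succ_iff_lt_or_eq.1 hbk with hlt | heq
      · exact Or.inl ⟨b, hb, hlt⟩
      · exact Or.inr (by rwa [← Fin.ext heq])
    · rintro (⟨b, hb, hlt⟩ | hk)
      · exact ⟨b, hb, Nat.lt_succ_of_lt hlt⟩
      · exact ⟨k, hk, Nat.lt_succ_self _⟩
  · rw [Equiv.Perm.one_apply, hneg j k, bne_iff_ne, ne_eq, decide_eq_decide, Fin.val_castSucc]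

/-- **Sliding-window triangular bijections** (`2^d` states — the framework at POLYNOMIAL width): the columns are the rows
transformed by `bit_a ↦ bit_a ⊕ g_a(bit_{a-1}, …, bit_{a-d})` for ARBITRARY Boolean functions `g_a` of the `d` bits below
(a nonlinear unitriangular bijection of the cube; `d = 1`, `g = id` is `x ↦ x ⊕ (x ≪ 1)`), for ANY injective layout of any size
`r ≤ 2^h`. Hit at width `2^(d+1) ≤ (2h)^c` (so windows `d = O(log h)` are in budget): read `x_0 y_0 x_1 y_1 …`, state = the window. -/
theorem partitionMinor_hit_of_slidingWindow (h c d : ℕ) (hd : 2 ^ d + 2 ^ d ≤ (h + h) ^ c) (hh : 4 ≤ h + h)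
    (g : Fin h → (Fin d → Bool) → Bool)
    {r : ℕ} (u w : Fin r → Finset (Fin h)) (hw : Function.Injective w) (ψ : Equiv.Perm (Fin r))
    (hsw : ∀ j (a : Fin h), a ∈ w j ↔
      ¬ (a ∈ u (ψ j) ↔ g a (fun t => decide (∃ b ∈ u (ψ j), (b : ℕ) + t + 1 = a)) = true)) :
    ∃ f ∈ Literature.Barriers.ValiantsHypothesis.SmallCircuits ℂ (h + h) (3 * c + 3),
      (Matrix.of fun i j : Fin r => MvPolynomial.coeff
        (∑ a ∈ u i, Finsupp.single (Fin.castAdd h a) 1 + ∑ c ∈ w j, Finsupp.single (Fin.natAdd h c) 1) f).det ≠ 0 := by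
  classical
  -- states = windows `Fin d → Bool`, encoded into `Fin (2^d)`
  have hcard : Fintype.card (Fin d → Bool) = 2 ^ d := by simp
  let ι : (Fin d → Bool) → Fin (2 ^ d) := fun win => Fin.cast hcard (Fintype.equivFin (Fin d → Bool) win)
  have hι : Function.Injective ι := fun a b hab => (Fintype.equivFin _).injective (Fin.cast_injective _ hab)
  refine partitionMinor_hit_of_transducer (Q := Fin d → Bool) h (2 ^ d) c hd hh ι hι
    1 1 (fun _ win b => fun t => if (t : ℕ) = 0 then b else win ⟨(t : ℕ) - 1, by omega⟩)
    (fun a win b => b != g a win) (fun _ => false) u w hw ψ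
    (fun i n => fun t => decide (∃ b ∈ u i, (b : ℕ) + t + 1 = n)) (fun i => ?_) (fun i k => ?_) fun j k => ?_
  · funext t
    simp only [Fin.val_zero, decide_eq_false_iff_not, not_exists, not_and]
    intro b _ hb; omega
  · funext t
    rw [Bool.eq_iff_iff]
    simp only [Fin.val_succ, Equiv.Perm.one_apply, Fin.val_castSucc]
    split_ifs with ht
    · simp only [decide_eq_true_eq]
      constructor
      · rintro ⟨b, hb, hbk⟩; rwa [← show b = k from Fin.ext (by omega)]
      · intro hk; exact ⟨k, hk, by omega⟩
    · simp only [decide_eq_true_eq]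
      constructor
      · rintro ⟨b, hb, hbk⟩; exact ⟨b, hb, by omega⟩
      · rintro ⟨b, hb, hbk⟩; exact ⟨b, hb, by omega⟩
  · simp only [Equiv.Perm.one_apply, Fin.val_castSucc]
    rw [hsw j k, bne_iff_ne, ne_eq, decide_eq_iff_iff]
    exact Iff.rfl

/-- **Prefix-parity layouts** (two states, unbounded memory — a finite-STATE but not finite-WINDOW map; the inverse of
`x ↦ x ⊕ (x ≪ 1)`): bit `a` of `w j` = parity of the bits `≤ a` of `u (ψ j)`, for ANY injective layout of any size `r ≤ 2^h`.
Hit at width 4 (`(2h)^c ≥ 4`, `h ≥ 2`): read `x_0 y_0 x_1 y_1 …`, state = the running parity. -/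
theorem partitionMinor_hit_of_prefixParity (h c : ℕ) (hc : 4 ≤ (h + h) ^ c) (hh : 4 ≤ h + h)
    {r : ℕ} (u w : Fin r → Finset (Fin h)) (hw : Function.Injective w) (ψ : Equiv.Perm (Fin r))
    (hpar : ∀ j (a : Fin h), a ∈ w j ↔ Odd ((u (ψ j)).filter fun b : Fin h => (b : ℕ) ≤ a).card) :
    ∃ f ∈ Literature.Barriers.ValiantsHypothesis.SmallCircuits ℂ (h + h) (3 * c + 3),
      (Matrix.of fun i j : Fin r => MvPolynomial.coeff
        (∑ a ∈ u i, Finsupp.single (Fin.castAdd h a) 1 + ∑ c ∈ w j, Finsupp.single (Fin.natAdd h c) 1) f).det ≠ 0 := by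
  classical
  -- the prefix below position `n` grows by `{k}` or by nothing
  have hstep : ∀ (A : Finset (Fin h)) (k : Fin h),
      (A.filter fun b : Fin h => (b : ℕ) ≤ k) =
        if k ∈ A then insert k (A.filter fun b : Fin h => (b : ℕ) < k) else A.filter fun b : Fin h => (b : ℕ) < k := by
    intro A k
    ext b
    split_ifs with hk
    · simp only [Finset.mem_filter, Finset.mem_insert]
      constructor
      · rintro ⟨hb, hbk⟩
        rcases Nat.lt_or_eq_of_le hbk with hlt | heq
        · exact Or.inr ⟨hb, hlt⟩
        · exact Or.inl (Fin.ext heq)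
      · rintro (rfl | ⟨hb, hlt⟩)
        · exact ⟨hk, le_rfl⟩
        · exact ⟨hb, hlt.le⟩
    · simp only [Finset.mem_filter]
      constructor
      · rintro ⟨hb, hbk⟩
        rcases Nat.lt_or_eq_of_le hbk with hlt | heq
        · exact ⟨hb, hlt⟩
        · exact absurd (Fin.ext heq ▸ hb) hk
      · rintro ⟨hb, hlt⟩; exact ⟨hb, hlt.le⟩
  refine partitionMinor_hit_of_transducer (Q := Bool) h 2 c hc hh (fun b => if b then 1 else 0)
    (fun b b' hb => by cases b <;> cases b' <;> simp_all)
    1 1 (fun _ par a => a != par) (fun _ par a => a != par) false u w hw ψ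
    (fun i n => decide (Odd ((u i).filter fun b : Fin h => (b : ℕ) < n).card)) (fun i => ?_) (fun i k => ?_) fun j k => ?_
  · simp
  · have hlt : ((u i).filter fun b : Fin h => (b : ℕ) < (k.succ : ℕ)) = (u i).filter fun b : Fin h => (b : ℕ) ≤ k := by
      ext b; simp
    rw [hlt, hstep (u i) k, Equiv.Perm.one_apply, Fin.val_castSucc, Bool.eq_iff_iff, bne_iff_ne, ne_eq,
      decide_eq_decide, decide_eq_true_iff]
    by_cases hk : k ∈ u i
    · rw [if_pos hk, Finset.card_insert_of_notMem (by simp), Nat.odd_add_one]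
      simp [hk]
    · rw [if_neg hk]
      simp [hk]
  · have hlt : ((u (ψ j)).filter fun b : Fin h => (b : ℕ) ≤ k) =
        if k ∈ u (ψ j) then insert k ((u (ψ j)).filter fun b : Fin h => (b : ℕ) < k)
        else (u (ψ j)).filter fun b : Fin h => (b : ℕ) < k := hstep _ k
    rw [Equiv.Perm.one_apply, hpar j k, hlt, bne_iff_ne, ne_eq, decide_eq_decide, Fin.val_castSucc]
    by_cases hk : k ∈ u (ψ j)
    · rw [if_pos hk, Finset.card_insert_of_notMem (by simp), Nat.odd_add_one]
      simp [hk]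
    · rw [if_neg hk]
      simp [hk]

end Summit.ValiantsHypothesis.Theorems.BarrierLever.RoabpDoor
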